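import Summits.CriticalPhenomena.PercolationContinuityZ3.Theorems.PercNearOneGluingNoHeavyLowerTailQuantitativeS5FloorExplicitCyl
import Summits.CriticalPhenomena.PercolationContinuityZ3.Theorems.PercNearOneGluingNoHeavyLowerTailQuantitativeGenZeroSet
import HarnessLib

/-!
# A LOCAL explicit floor for the master form (GEN): `surplus ≥ p₀^{N_{<a}}·(p₀(1−p₀))^{|R|+1}·J` from cylinder witnesses

Support file (`--supports stmt-CriticalPhenomena-4575`), prover seat `prim-rate-mine-2` (lane prim-rate, constants-miner (c), BENCH row
M2-R49 (c); `run/shared/lean/prim/prim-rate/prim-rate-mine-2/PROOFS.md` §P49).  No definitions, no named facts, no sorries; standard axioms.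

Completes the matrix {(S5), (GEN)} × {volume constant, local constant} of explicit floors from one isolated witness:
`CSH.s5dMargin_nil_ge_explicit_sharp` / `CSH.surplus_ge_explicit_sharp` (row M2-R48: `p₀^{|E|}·(p₀(1−p₀))^{|E|}·J`) and
`CSH.s5dMargin_nil_ge_explicit_cyl` (row M2-R49 (b): `p₀^{N_{<a}}·(p₀(1−p₀))^{|R|+1}·J`); THIS FILE:
* `CSH.surplus_ge_explicit_cyl` — relays `A`, top relay `k`, `o ∉ A`, a relay `a ∈ A ∖ k`, a pair `e ∈ E` missing `(A∖k)_{<a}`, cylinder witnesses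
  `(R₁, η₁)` (the `F(V 𝒞_a)`-jump) and `(R₂, η₂)` (pivotality of `e` for the floor's event at `a`, second observer `k`) over the configurations inside
  the pairs of `E` missing `(A∖k)_{<a}`, `R₁ ∪ R₂ ⊆ R`: **`p₀^{N_{<a}}·(p₀(1−p₀))^{|R|+1}·J ≤ surplus w A r F o`** (`Sur_o(A) ≥ s5dMargin(A∖k; o, k)` from
  the GEN peeling identity `CSH.surplus_peel_top` with its two other pieces `≥ 0`, `CSH.surplus_pieces_nonneg`, then `s5dMargin_nil_ge_explicit_cyl`).
[cite: KozmaNitzan2024, Conj. 4 (p. 32), Lemma 2 (p. 6)] [cite: Harris1960, Lemma 4.1 (p. 16)] [cite: Talagrand1996, Thm. 1.1 (p. 244)]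
-/

noncomputable section

namespace Summit.CriticalPhenomena.PercolationContinuityZ3.Theorems

open MeasureTheory Set Literature.Probability.LatticeModels Literature.Probability.Percolation
open scoped Classical
open KNPreFKG

namespace CSH

variable {n : ℕ}

/-- **LOCAL explicit master-form (GEN) surplus (cylinder witnesses).**  Weights `w = 0` off the finite support `E`, `p₀ ≤ w ≤ 1 − p₀` on `E`
(`0 < p₀`); relays `A` with a rank `r` injective on `A`, compatible with the means, and rank-maximal relay `k ∈ A`; observer `o ∉ A`; `F` monotone
nonnegative; a relay `a ∈ A ∖ k`, a pair `e ∈ E` missing `(A∖k)_{<a}`, and CYLINDER witnesses `(R₁, η₁)` (an `F(V 𝒞_a)`-jump `≥ J ≥ 0` at `e`) and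
`(R₂, η₂)` (`e` pivotal for the floor's event at `a`, second observer `k`) over the configurations inside the pairs of `E` missing `(A∖k)_{<a}`, with
`R₁ ∪ R₂ ⊆ R`.  Then **`p₀^{N_{<a}}·(p₀(1−p₀))^{|R|+1}·J ≤ surplus w A r F o`**, `N_{<a}` = #pairs of `E` meeting `(A∖k)_{<a}` — no factor depends on `|E|`
(`Sur_o(A) ≥ s5dMargin(A∖k; o, k)` by the GEN peeling identity, then `s5dMargin_nil_ge_explicit_cyl`).
[cite: KozmaNitzan2024, Conj. 4 (p. 32), Lemma 2 (p. 6)] [cite: Harris1960, Lemma 4.1 (p. 16)] -/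
theorem surplus_ge_explicit_cyl (w : Sym2 (Fin n) → unitInterval) (E : Finset (Sym2 (Fin n))) (p₀ : ℝ) (hp0 : 0 < p₀)
    (hE0 : ∀ f, f ∉ E → (w f : ℝ) = 0) (hE1 : ∀ f ∈ E, p₀ ≤ (w f : ℝ) ∧ (w f : ℝ) ≤ 1 - p₀)
    (A : Finset (Fin n)) (r : Fin n → ℕ) (hr : Set.InjOn r ↑A) (k : Fin n) (hkA : k ∈ A) (hkmax : ∀ a ∈ A, r a ≤ r k)
    (o : Fin n) (hoA : o ∉ A)
    (F : Set (Fin n) → ℝ) (hF : ∀ S S' : Set (Fin n), S ⊆ S' → F S ≤ F S') (hF0 : ∀ S : Set (Fin n), 0 ≤ F S)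
    (hcompat : ∀ a ∈ A, ∀ a' ∈ A, r a < r a' →
      ∫ ω, F (openCluster ω a) ∂(prodBernoulli w) ≤ ∫ ω, F (openCluster ω a') ∂(prodBernoulli w))
    (a : Fin n) (ha : a ∈ A.erase k)
    (e : Sym2 (Fin n)) (heE : e ∈ E) (heY : ∀ y ∈ (↑((A.erase k).filter (fun b => r b < r a)) : Set (Fin n)), y ∉ e)
    (R R₁ R₂ : Finset (Sym2 (Fin n)))
    (hR : ∀ g ∈ R, g ∈ E ∧ g ≠ e ∧ ∀ y ∈ (↑((A.erase k).filter (fun b => r b < r a)) : Set (Fin n)), y ∉ g)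
    (hR₁ : R₁ ⊆ R) (hR₂ : R₂ ⊆ R)
    (η₁ η₂ : Set (Sym2 (Fin n))) (J : ℝ) (hJ : 0 ≤ J)
    (hc₁ : ∀ ω : Set (Sym2 (Fin n)), ω ⊆ ↑(E.filter (fun g => ∀ y ∈ (↑((A.erase k).filter (fun b => r b < r a)) : Set (Fin n)), y ∉ g)) →
      (∀ g ∈ R₁, (g ∈ ω ↔ g ∈ η₁)) →
      J ≤ F {c | c = a ∨ ∃ e' ∈ openEdgeCluster (insert e ω) a, c ∈ e'} - F {c | c = a ∨ ∃ e' ∈ openEdgeCluster (ω \ {e}) a, c ∈ e'})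
    (hc₂ : ∀ ω : Set (Sym2 (Fin n)), ω ⊆ ↑(E.filter (fun g => ∀ y ∈ (↑((A.erase k).filter (fun b => r b < r a)) : Set (Fin n)), y ∉ g)) →
      (∀ g ∈ R₂, (g ∈ ω ↔ g ∈ η₂)) →
      insert e ω ∈ ((⋃ t ∈ (insert a ((A.erase k).filter (fun b => r a < r b) ∪ ([] : List (Fin n)).toFinset)), openConn o t) ∪
          openConn o k : Set (BondConfig (Fin n))) ∧
        ω \ {e} ∉ ((⋃ t ∈ (insert a ((A.erase k).filter (fun b => r a < r b) ∪ ([] : List (Fin n)).toFinset)), openConn o t) ∪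
          openConn o k : Set (BondConfig (Fin n)))) :
    p₀ ^ (E.filter (fun g : Sym2 (Fin n) => ∃ y ∈ (↑((A.erase k).filter (fun b => r b < r a)) : Set (Fin n)), y ∈ g)).card *
        (p₀ * (1 - p₀)) ^ (R.card + 1) * J ≤
      surplus w A r F o := by
  set μ := prodBernoulli w with hμ
  set T : Finset (Fin n) := A.erase k with hT
  have hTA : ∀ b ∈ T, b ∈ A := fun b hb => Finset.mem_of_mem_erase hb
  have hkT : k ∉ T := Finset.notMem_erase k A
  have hoT : o ∉ T := fun h => hoA (hTA o h)
  have hok : o ≠ k := fun h => hoA (h ▸ hkA)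
  have hrT : Set.InjOn r ↑T := hr.mono (fun b hb => Finset.mem_of_mem_erase hb)
  have hcompatT : ∀ b ∈ T, ∀ b' ∈ T, r b < r b' →
      ∫ ω, F (openCluster ω b) ∂μ ≤ ∫ ω, F (openCluster ω b') ∂μ := fun b hb b' hb' h => hcompat b (hTA b hb) b' (hTA b' hb') h
  -- the (S5) floor at the second observer `k`
  have hs5 := s5dMargin_nil_ge_explicit_cyl w E p₀ hp0 hE0 hE1 T r hrT o k hoT hkT hok F hF hF0 hcompatT a ha e heE heY
    R R₁ R₂ hR hR₁ hR₂ η₁ η₂ J hJ hc₁ hc₂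
  -- `Sur_o(A) ≥ s5dMargin(T; o, k)` from the peeling identity
  have hE0' : ∀ f, f ∉ (↑E : Set (Sym2 (Fin n))) → (w f : ℝ) = 0 := fun f hf => hE0 f (fun h => hf (Finset.mem_coe.2 h))
  have hE1' : ∀ f ∈ (↑E : Set (Sym2 (Fin n))), 0 < (w f : ℝ) ∧ (w f : ℝ) < 1 := fun f hf => by
    have h := hE1 f (Finset.mem_coe.1 hf)
    exact ⟨lt_of_lt_of_le hp0 h.1, by linarith [h.2]⟩
  have hw : ∀ g, w g < 1 := by
    intro g
    by_cases hg : g ∈ E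
    · exact_mod_cast (show (w g : ℝ) < 1 by linarith [(hE1 g hg).2])
    · exact_mod_cast (show (w g : ℝ) < 1 by rw [hE0 g hg]; norm_num)
  obtain ⟨-, h2, h3⟩ := surplus_pieces_nonneg w (↑E) hE0' hE1' A r hr k hkA o hoA F hF hF0 hcompat
  have hid := surplus_peel_top w hw A r F o k hkA hr hkmax
  have hempty : (∅ : BondConfig (Fin n)) ∈
      {ω : BondConfig (Fin n) | ∀ b ∈ (↑(A.erase k) : Set (Fin n)), ¬ (openGraph ω).Reachable k b} := by
    intro b hb h
    rw [HullPort.reachable_empty_iff] at h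
    subst h
    exact (Finset.notMem_erase k A) (Finset.mem_coe.1 hb)
  have hDpos : 0 < μ.real {ω : BondConfig (Fin n) | ∀ b ∈ (↑(A.erase k) : Set (Fin n)), ¬ (openGraph ω).Reachable k b} :=
    prodBernoulli_real_pos_of_empty_mem w hw hempty
  have hmul : μ.real {ω : BondConfig (Fin n) | ∀ b ∈ (↑(A.erase k) : Set (Fin n)), ¬ (openGraph ω).Reachable k b} *
        s5dMargin w (A.erase k) r [] o k F ≤
      μ.real {ω : BondConfig (Fin n) | ∀ b ∈ (↑(A.erase k) : Set (Fin n)), ¬ (openGraph ω).Reachable k b} * surplus w A r F o := by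
    rw [hid]
    linarith [h3, mul_nonneg h2 (measureReal_nonneg :
      0 ≤ μ.real ({ω : BondConfig (Fin n) | ∀ b ∈ (↑(A.erase k) : Set (Fin n)), ¬ (openGraph ω).Reachable k b} ∩ openConn o k))]
  have hSur : s5dMargin w (A.erase k) r [] o k F ≤ surplus w A r F o := le_of_mul_le_mul_left hmul hDpos
  exact hs5.trans hSur

end CSH

end Summit.CriticalPhenomena.PercolationContinuityZ3.Theorems

end
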